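import Mathlib

/-!
# `SnSubsetDichotomy.HyperoctahedralSubsets`, line `spherical-rank-sieve` — stub `stub_triplesToGroup`

The bridge from support-disjoint commuting local triples to a hosted product-one triple group
(crux `stmt-MatrixMultiplication-8305`, registered stub `stub_triplesToGroup` of the lead's skeleton
for line `spherical-rank-sieve`).

Data: permutations `μ 0, μ 1, μ 2` of `Fin n` (no hypothesis on them) and `g` local triples:
commuting involutions `a j, b j` (not both trivial) with `a j` commuting with `μ 0`, `b j` with
`μ 1`, `a j * b j` with `μ 2`, and such that for `j ≠ j'` every point moved by `a j` or `b j` is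
fixed by `a j'` and `b j'`.  Claim: there is a finite set `T` of permutation triples containing `1`,
closed under componentwise `*` and `⁻¹`, every `(x, y, z) ∈ T` being hosted (`x ∈ C(μ 0)`,
`y ∈ C(μ 1)`, `z ∈ C(μ 2)`) with `x * y * z = 1`, and `2 ^ g ≤ |T|`.

Proof.  All `a j, b j'` pairwise commute (equal indices by hypothesis, distinct indices because the
supports are disjoint, `Equiv.Perm.Disjoint.commute`), so the subgroup `H` they generate is
commutative (`Subgroup.isMulCommutative_closure`) and we may use `Finset.prod` in `H`.  For
`f : Fin g → Bool` put `A f := ∏ⱼ [f j] a j`, `B f := ∏ⱼ [f j] b j`, `C f := ∏ⱼ [f j] (a j * b j)` and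
`T := {(A f, B f, C f)}`.  Since all generators are involutions, `A f * A f' = A (f xor f')` (and
likewise for `B`, `C`), which gives closure under `*`, `A f * A f = 1` (closure under `⁻¹`) and
`A f * B f * C f = ∏ⱼ [f j] (a j b j)² = 1`; the hosts are closed under products; `1` is the image of
the constant function `false`; and `f ↦ (A f, B f, C f)` is injective: if `f j ≠ f' j` and, say,
`a j ≠ 1` moves `v`, then all other generators fix `v`, so `A f v` and `A f' v` are `a j v ≠ v` and `v`
in some order.  Hence `|T| = 2 ^ g`.
-/

namespace Summit.MatrixMultiplication.MatrixMultiplication.Theorems.HyperoctahedralSubsets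

open scoped IsMulCommutative
open Equiv

namespace TriplesToGroup

variable {ι M : Type*} [Fintype ι]

/-- Boolean-indicator products of involutions in a commutative monoid multiply by `xor` of the
indicators. [folklore] -/
theorem prod_ite_mul_prod_ite [CommMonoid M] (γ : ι → M) (hγ : ∀ i, γ i * γ i = 1)
    (f f' : ι → Bool) :
    (∏ i, if f i then γ i else 1) * (∏ i, if f' i then γ i else 1) =
      ∏ i, if (f i ^^ f' i) then γ i else 1 := by
  rw [← Finset.prod_mul_distrib]
  refine Finset.prod_congr rfl fun i _ => ?_
  cases f i <;> cases f' i <;> simp [hγ i]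

/-- A Boolean-indicator product of involutions in a commutative monoid is an involution.
[folklore] -/
theorem prod_ite_mul_self [CommMonoid M] (γ : ι → M) (hγ : ∀ i, γ i * γ i = 1) (f : ι → Bool) :
    (∏ i, if f i then γ i else 1) * (∏ i, if f i then γ i else 1) = 1 := by
  rw [prod_ite_mul_prod_ite γ hγ]
  simp

/-- In a commutative subgroup, a product of elements commuting with `μ` commutes with `μ`.
[folklore] -/
theorem coe_prod_mul_comm {G : Type*} [Group G] (H : Subgroup G) [IsMulCommutative H]
    (s : ι → H) (μ : G) (h : ∀ i, (s i : G) * μ = μ * s i) :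
    ((∏ i, s i : H) : G) * μ = μ * ((∏ i, s i : H) : G) := by
  refine Finset.prod_induction s (fun x : H => (x : G) * μ = μ * x) ?_ ?_ ?_
  · intro x y hx hy
    rw [Subgroup.coe_mul, mul_assoc, hy, ← mul_assoc, hx, mul_assoc]
  · simp
  · exact fun i _ => h i

/-- Evaluation of a product of permutations in a commutative subgroup at a point fixed by all but
one factor. [folklore] -/
theorem coe_prod_apply {X : Type*} [DecidableEq ι] (H : Subgroup (Perm X)) [IsMulCommutative H]
    (s : ι → H) (j : ι) (v : X) (h : ∀ i, i ≠ j → (s i : Perm X) v = v) :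
    ((∏ i, s i : H) : Perm X) v = (s j : Perm X) v := by
  rw [← Finset.mul_prod_erase Finset.univ s (Finset.mem_univ j), Subgroup.coe_mul, Perm.mul_apply]
  congr 1
  refine Finset.prod_induction s (fun x : H => (x : Perm X) v = v) ?_ ?_ ?_
  · intro x y hx hy
    rw [Subgroup.coe_mul, Perm.mul_apply, hy, hx]
  · simp
  · exact fun i hi => h i (Finset.ne_of_mem_erase hi)

/-- The bridge, for generators taken in a commutative subgroup `H` of `Perm (Fin n)`: Boolean
products of the local triples form a hosted product-one triple group of order `2 ^ g`.
[folklore] -/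
theorem exists_tripleGroup {n g : ℕ} (μ : Fin 3 → Perm (Fin n)) (H : Subgroup (Perm (Fin n)))
    [IsMulCommutative H] (α β : Fin g → H)
    (hαα : ∀ j, (α j : Perm (Fin n)) * α j = 1) (hββ : ∀ j, (β j : Perm (Fin n)) * β j = 1)
    (hne : ∀ j, (α j : Perm (Fin n)) ≠ 1 ∨ (β j : Perm (Fin n)) ≠ 1)
    (hμ0 : ∀ j, (α j : Perm (Fin n)) * μ 0 = μ 0 * α j)
    (hμ1 : ∀ j, (β j : Perm (Fin n)) * μ 1 = μ 1 * β j)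
    (hμ2 : ∀ j, (α j : Perm (Fin n)) * β j * μ 2 = μ 2 * (α j * β j))
    (hdisj : ∀ j j' : Fin g, j ≠ j' → ∀ v,
      ((α j : Perm (Fin n)) v ≠ v ∨ (β j : Perm (Fin n)) v ≠ v) →
        (α j' : Perm (Fin n)) v = v ∧ (β j' : Perm (Fin n)) v = v) :
    ∃ T : Finset (Perm (Fin n) × Perm (Fin n) × Perm (Fin n)),
      (1 : Perm (Fin n) × Perm (Fin n) × Perm (Fin n)) ∈ T ∧
      (∀ s ∈ T, ∀ t ∈ T, s * t ∈ T) ∧ (∀ t ∈ T, t⁻¹ ∈ T) ∧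
      (∀ t ∈ T, t.1 * μ 0 = μ 0 * t.1 ∧ t.2.1 * μ 1 = μ 1 * t.2.1 ∧ t.2.2 * μ 2 = μ 2 * t.2.2 ∧
        t.1 * t.2.1 * t.2.2 = 1) ∧
      2 ^ g ≤ T.card := by
  classical
  -- involutions, at the level of `H`
  have hαα' : ∀ j, α j * α j = 1 := fun j => Subtype.ext (by simpa using hαα j)
  have hββ' : ∀ j, β j * β j = 1 := fun j => Subtype.ext (by simpa using hββ j)
  have hδδ : ∀ j, α j * β j * (α j * β j) = 1 := fun j => by
    rw [mul_mul_mul_comm, hαα', hββ', one_mul]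
  -- the map `f ↦ (A f, B f, C f)`
  set F : (Fin g → Bool) → Perm (Fin n) × Perm (Fin n) × Perm (Fin n) := fun f =>
    (((∏ j, if f j then α j else 1 : H) : Perm (Fin n)),
      ((∏ j, if f j then β j else 1 : H) : Perm (Fin n)),
      ((∏ j, if f j then α j * β j else 1 : H) : Perm (Fin n))) with hF
  have hmul : ∀ f f', F f * F f' = F (fun j => f j ^^ f' j) := fun f f' => by
    simp only [hF, Prod.mk_mul_mk, ← Subgroup.coe_mul, prod_ite_mul_prod_ite _ hαα',
      prod_ite_mul_prod_ite _ hββ', prod_ite_mul_prod_ite _ hδδ]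
  have hone : F (fun _ => false) = 1 := by
    simp only [hF, Bool.false_eq_true, if_false, Finset.prod_const_one, Subgroup.coe_one]
    rfl
  have hinv : ∀ f, (F f)⁻¹ = F f := fun f => by
    simp only [hF, Prod.inv_mk, ← Subgroup.coe_inv,
      inv_eq_of_mul_eq_one_right (prod_ite_mul_self _ hαα' f),
      inv_eq_of_mul_eq_one_right (prod_ite_mul_self _ hββ' f),
      inv_eq_of_mul_eq_one_right (prod_ite_mul_self _ hδδ f)]
  refine ⟨Finset.univ.image F, Finset.mem_image.2 ⟨fun _ => false, Finset.mem_univ _, hone⟩,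
    ?_, ?_, ?_, ?_⟩
  · intro s hs t ht
    obtain ⟨f, -, rfl⟩ := Finset.mem_image.1 hs
    obtain ⟨f', -, rfl⟩ := Finset.mem_image.1 ht
    exact Finset.mem_image.2 ⟨_, Finset.mem_univ _, (hmul f f').symm⟩
  · intro t ht
    obtain ⟨f, -, rfl⟩ := Finset.mem_image.1 ht
    rw [hinv]
    exact Finset.mem_image_of_mem F (Finset.mem_univ f)
  · intro t ht
    obtain ⟨f, -, rfl⟩ := Finset.mem_image.1 ht
    refine ⟨?_, ?_, ?_, ?_⟩
    · refine coe_prod_mul_comm H _ (μ 0) fun i => ?_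
      cases f i
      · simp
      · simpa using hμ0 i
    · refine coe_prod_mul_comm H _ (μ 1) fun i => ?_
      cases f i
      · simp
      · simpa using hμ1 i
    · refine coe_prod_mul_comm H _ (μ 2) fun i => ?_
      cases f i
      · simp
      · simpa using hμ2 i
    · change ((∏ j, if f j then α j else 1 : H) : Perm (Fin n)) *
          ((∏ j, if f j then β j else 1 : H) : Perm (Fin n)) *
          ((∏ j, if f j then α j * β j else 1 : H) : Perm (Fin n)) = 1
      rw [← Subgroup.coe_mul, ← Subgroup.coe_mul, ← Finset.prod_mul_distrib,
        ← Finset.prod_mul_distrib, Finset.prod_eq_one fun i _ => ?_, Subgroup.coe_one]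
      cases f i
      · simp
      · simpa using hδδ i
  · rw [Finset.card_image_of_injective _ fun f f' hff' => ?_]
    · simp
    -- injectivity of `F`
    by_contra hff
    obtain ⟨j, hj⟩ := Function.ne_iff.1 hff
    simp only [hF, Prod.mk.injEq] at hff'
    obtain ⟨h1, h2, -⟩ := hff'
    rcases hne j with hαj | hβj
    · obtain ⟨v, hv⟩ : ∃ v, (α j : Perm (Fin n)) v ≠ v := by
        by_contra! h
        exact hαj (Equiv.ext h)
      have eA : ∀ f₀ : Fin g → Bool, ((∏ i, if f₀ i then α i else 1 : H) : Perm (Fin n)) v =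
          ((if f₀ j then α j else 1 : H) : Perm (Fin n)) v := fun f₀ =>
        coe_prod_apply H _ j v fun i hi => by
          cases f₀ i
          · simp
          · simpa using (hdisj j i (Ne.symm hi) v (Or.inl hv)).1
      have h1v : ((∏ i, if f i then α i else 1 : H) : Perm (Fin n)) v =
          ((∏ i, if f' i then α i else 1 : H) : Perm (Fin n)) v := by rw [h1]
      rw [eA f, eA f'] at h1v
      revert hj h1v
      cases f j <;> cases f' j <;> simp [hv, hv.symm]
    · obtain ⟨v, hv⟩ : ∃ v, (β j : Perm (Fin n)) v ≠ v := by
        by_contra! h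
        exact hβj (Equiv.ext h)
      have eB : ∀ f₀ : Fin g → Bool, ((∏ i, if f₀ i then β i else 1 : H) : Perm (Fin n)) v =
          ((if f₀ j then β j else 1 : H) : Perm (Fin n)) v := fun f₀ =>
        coe_prod_apply H _ j v fun i hi => by
          cases f₀ i
          · simp
          · simpa using (hdisj j i (Ne.symm hi) v (Or.inr hv)).2
      have h2v : ((∏ i, if f i then β i else 1 : H) : Perm (Fin n)) v =
          ((∏ i, if f' i then β i else 1 : H) : Perm (Fin n)) v := by rw [h2]
      rw [eB f, eB f'] at h2v
      revert hj h2v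
      cases f j <;> cases f' j <;> simp [hv, hv.symm]

end TriplesToGroup

open TriplesToGroup in
/-- **Stub `stub_triplesToGroup` — the bridge** (line `spherical-rank-sieve` of crux
`SnSubsetDichotomy.HyperoctahedralSubsets`, stmt-MatrixMultiplication-8305).  `g` support-disjoint
commuting local triples (`a j ∈ C(μ 0)`, `b j ∈ C(μ 1)` commuting involutions, not both trivial,
with `a j * b j ∈ C(μ 2)`) generate a finite set of permutation triples containing `1`, closed
under componentwise `*` and `⁻¹`, hosted with product one, of size `≥ 2 ^ g` (the Boolean products
of the triples inside the commutative subgroup generated by all `a j, b j`;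
`TriplesToGroup.exists_tripleGroup`). [folklore] -/
theorem stub_triplesToGroup : ∀ (n : ℕ) (μ : Fin 3 → Equiv.Perm (Fin n)) (g : ℕ) (a b : Fin g → Equiv.Perm (Fin n)), (∀ j, a j * a j = 1 ∧ b j * b j = 1 ∧ a j * b j = b j * a j ∧ (a j ≠ 1 ∨ b j ≠ 1) ∧ a j * μ 0 = μ 0 * a j ∧ b j * μ 1 = μ 1 * b j ∧ a j * b j * μ 2 = μ 2 * (a j * b j)) → (∀ j j' : Fin g, j ≠ j' → ∀ v, (a j v ≠ v ∨ b j v ≠ v) → a j' v = v ∧ b j' v = v) → ∃ T : Finset (Equiv.Perm (Fin n) × Equiv.Perm (Fin n) × Equiv.Perm (Fin n)), (1 : Equiv.Perm (Fin n) × Equiv.Perm (Fin n) × Equiv.Perm (Fin n)) ∈ T ∧ (∀ s ∈ T, ∀ t ∈ T, s * t ∈ T) ∧ (∀ t ∈ T, t⁻¹ ∈ T) ∧ (∀ t ∈ T, t.1 * μ 0 = μ 0 * t.1 ∧ t.2.1 * μ 1 = μ 1 * t.2.1 ∧ t.2.2 * μ 2 = μ 2 * t.2.2 ∧ t.1 *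 t.2.1 * t.2.2 = 1) ∧ 2 ^ g ≤ T.card := by
  intro n μ g a b hloc hdisj
  -- two permutations commute as soon as every point moved by the first is fixed by the second
  have key : ∀ σ τ : Perm (Fin n), (∀ v, σ v ≠ v → τ v = v) → σ * τ = τ * σ := fun σ τ h =>
    (Perm.Disjoint.commute fun v => (em (σ v = v)).imp_right (h v)).eq
  -- all generators pairwise commute
  have hk : ∀ x ∈ Set.range a ∪ Set.range b, ∀ y ∈ Set.range a ∪ Set.range b, x * y = y * x := by
    rintro x (⟨j, rfl⟩ | ⟨j, rfl⟩) y (⟨j', rfl⟩ | ⟨j', rfl⟩)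
    · by_cases hjj : j = j'
      · rw [hjj]
      · exact key _ _ fun v hv => (hdisj j j' hjj v (Or.inl hv)).1
    · by_cases hjj : j = j'
      · rw [hjj]
        exact (hloc j').2.2.1
      · exact key _ _ fun v hv => (hdisj j j' hjj v (Or.inl hv)).2
    · by_cases hjj : j = j'
      · rw [hjj]
        exact (hloc j').2.2.1.symm
      · exact key _ _ fun v hv => (hdisj j j' hjj v (Or.inr hv)).1
    · by_cases hjj : j = j'
      · rw [hjj]
      · exact key _ _ fun v hv => (hdisj j j' hjj v (Or.inr hv)).2
  haveI := Subgroup.isMulCommutative_closure hk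
  exact exists_tripleGroup μ (Subgroup.closure (Set.range a ∪ Set.range b))
    (fun j => ⟨a j, Subgroup.subset_closure (Or.inl ⟨j, rfl⟩)⟩)
    (fun j => ⟨b j, Subgroup.subset_closure (Or.inr ⟨j, rfl⟩)⟩)
    (fun j => (hloc j).1) (fun j => (hloc j).2.1) (fun j => (hloc j).2.2.2.1)
    (fun j => (hloc j).2.2.2.2.1) (fun j => (hloc j).2.2.2.2.2.1) (fun j => (hloc j).2.2.2.2.2.2)
    hdisj

end Summit.MatrixMultiplication.MatrixMultiplication.Theorems.HyperoctahedralSubsets
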